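import Mathlib
import HarnessLib
import Summits.Ventures.LatticeQCDFlow.Exactness.SUNJitteredHMCCertificates
import Summits.Ventures.LatticeQCDFlow.Exactness.JitteredHMCReversible

/-!
# The engine's jittered `SU(N)` HMC for an ARBITRARY label law — continuous trajectory-length jitter included: joint measurability, the kernel, exactness for every law

HONEST FRAMING: exact (Metropolis-corrected) sampling algorithms for lattice gauge theory;
figures of merit are autocorrelation/cost numbers at stated couplings and volumes; no
continuum-physics claim.

Venture `LatticeQCDFlow` (cell pub-lqcd), topic `Exactness`, FANOUT row 9 (eng-latcore, GEN-24; the engine's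
`latflow.core.hmc.HMC.trajectory(rng, τ, nstep, tau_jitter = j)`: the trajectory length is drawn as
`τ(1 + j(2u − 1))`, `u ∼ U(0,1)` — an ATOMLESS law on `ℝ` in exact arithmetic).  NEW WORK of the cell over the tree
(GEN-22's `JitteredHMC.lean`: `jitterMap`, `measurable_jitterMap` — joint measurability suffices for ANY label space —,
`jitterHMC`, `jitterHMC_apply`, `jitterHMC_exact`, `isMarkovKernel_jitterHMC`; `SUNJitteredLeapfrogHMC.lean`: the
COUNTABLE-label kernel `sunJitterHMCN`; `SUNMultiStepLeapfrogHMC.lean`: `sunLeapfrogProposalN`,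
`involutive_/measurePreserving_sunLeapfrogProposalN`; `SUNJitteredHMCCertificates.lean`: the countable-label engine
kernel `wilsonJitterHMC`; `SUNWilsonForceLaw.lean`).  Nothing is cited as a fact; no number is claimed.

WHY.  Every jitter file of the tree takes the labels on a COUNTABLE set (slice-wise measurability; the code's 53-bit
uniform is such a law).  The idealised `tau_jitter` law is uniform on an interval.  `JitteredHMC.lean` already allows
any label space once `(l, (U, p)) ↦ Ψ_l(U, p)` is JOINTLY measurable; this file proves that joint measurability for
the leapfrog proposal with label-dependent step size, increment and step number, names the kernel, and records
exactness for EVERY probability law of the labels — in particular for every Borel law of the trajectory length.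

## Content

* §1 **`measurable_uncurry_sunLeapfrogProposalN`** — for measurable `ε : Lab → ℝ`, `N : Lab → ℕ` and jointly
  measurable `(l, U) ↦ g_l(U)`, the map `(l, (U, p)) ↦ Ψ^{N_l}_{ε_l, g_l}(U, p)` is measurable (drift: continuity of
  `(ε, p) ↦ exp(ε ι p)`; kick: joint measurability of `g`; the label-dependent number of steps: countable union);
  **`measurable_jitterMap_sunLeapfrogProposalN`**.
* §2 **`sunJitterHMCL`** — the jittered `n`-step kernel on `SU(N)^links` for an ARBITRARY measurable label space;
  `sunJitterHMCL_apply` (`K(U, A) = ∫ K_l(U, A) η(dl)`, the frozen-label kernels being the tree's `sunLeapfrogHMCN`);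
  **`sunJitterHMCL_invariant`** / `_gibbs` — EXACT FOR EVERY probability law `η`; `isMarkovKernel_sunJitterHMCL`.
* §3 **`wilsonJitterHMCL N d L β nstep η`** — THE ENGINE AS RUN with a general law `η` OF THE TRAJECTORY LENGTH
  (labels `= ℝ`, `nstep` fixed, step `τ'/nstep`, THE ENGINE'S half kick `−(τ'/2nstep)·F`, `F = sunWilsonForceLaw`,
  Metropolis test on `(β/N)·S_W + T`); Markov; **`wilsonJitterHMCL_invariant`** — `wilsonMeasure (β/N)` is invariant
  for EVERY `nstep`, EVERY Borel probability law `η` on `ℝ` (atomless or not); **`wilsonJitterHMCL_apply`**.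
* §4 **`smul_le_wilsonJitterHMCL_of_common_minorant`** — if ONE family of measures `W(U, ·)` minorises the frozen-length
  engine kernels for every length in a Borel set `G`, then `η(G) • W(U, ·) ≤ K(U, ·)` for every `U` (the
  instance-ready form of GEN-23's `JitteredHMCCommonMinorant.lean`, proved here for this kernel from `jitterHMC_apply`).

NOT CLAIMED here: convergence (next file, `SUNJitteredHMCAtomless.lean`, with the uniform box minorant of
`SUNLeapfrogHMCUniformMinorant.lean`); any rate; floating point.
-/

noncomputable section

namespace Summit.Ventures.LatticeQCDFlow.Exactness

open MeasureTheory ProbabilityTheory ProbabilityTheory.Kernel Set Metric Function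
open Literature.MathematicalPhysics.QuantumFieldTheory
open Literature.MathematicalPhysics.QuantumLattice (fundamentalRep continuous_fundamentalRep)
open scoped ENNReal Matrix Matrix.Norms.Operator NNReal

set_option backward.isDefEq.respectTransparency false

/-! ## §1 Joint measurability of the labelled leapfrog proposal -/

section Measurable

variable {n : Type*} [Fintype n] [DecidableEq n]
variable {E : Type*} [NormedAddCommGroup E] [NormedSpace ℝ E] [MeasurableSpace E] [BorelSpace E]
  [FiniteDimensional ℝ E]
variable (ι : E →ₗ[ℝ] Matrix n n ℂ) (hι : ∀ a, (ι a)ᴴ = -ι a ∧ (ι a).trace = 0)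
variable {L : Type*}
variable {Lab : Type*} [MeasurableSpace Lab]
variable {ε : Lab → ℝ} {g : Lab → (L → Matrix.specialUnitaryGroup n ℂ) → L → E} {N : Lab → ℕ}

/-- A jointly measurable two-argument map has measurable slices. -/
theorem measurable_slice_of_uncurry {α β γ : Type*} [MeasurableSpace α] [MeasurableSpace β] [MeasurableSpace γ]
    {f : α → β → γ} (hf : Measurable fun q : α × β => f q.1 q.2) (a : α) : Measurable (f a) :=
  hf.comp measurable_prodMk_left

/-- The labelled kick `(l, (U, p)) ↦ (U, p + g_l(U))` is jointly measurable. -/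
theorem measurable_uncurry_kick (hg : Measurable fun q : Lab × (L → Matrix.specialUnitaryGroup n ℂ) => g q.1 q.2) :
    Measurable fun q : Lab × ((L → Matrix.specialUnitaryGroup n ℂ) × (L → E)) => kick (g q.1) q.2 := by
  have h1 : Measurable fun q : Lab × ((L → Matrix.specialUnitaryGroup n ℂ) × (L → E)) => g q.1 q.2.1 :=
    hg.comp (measurable_fst.prodMk (measurable_fst.comp measurable_snd))
  exact (measurable_fst.comp measurable_snd).prodMk ((measurable_snd.comp measurable_snd).add h1)

/-- The labelled drift `(l, (U, p)) ↦ ((exp(ε_l ι p_j) U_j)_j, p)` is jointly measurable. -/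
theorem measurable_uncurry_drift (hε : Measurable ε) :
    Measurable fun q : Lab × ((L → Matrix.specialUnitaryGroup n ℂ) × (L → E)) =>
      drift (mulDrift (sunExpDrift (L := L) ι hι (ε q.1))) q.2 := by
  have hexp : Measurable fun q : Lab × ((L → Matrix.specialUnitaryGroup n ℂ) × (L → E)) =>
      sunExpDrift (L := L) ι hι (ε q.1) q.2.2 := by
    refine measurable_pi_lambda _ fun j => ?_
    have hsm : Measurable fun q : Lab × ((L → Matrix.specialUnitaryGroup n ℂ) × (L → E)) => ε q.1 • q.2.2 j :=
      (hε.comp measurable_fst).smul ((measurable_pi_apply j).comp (measurable_snd.comp measurable_snd))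
    exact (continuous_suExp ι hι).measurable.comp hsm
  exact (hexp.mul (measurable_fst.comp measurable_snd)).prodMk (measurable_snd.comp measurable_snd)

/-- One labelled leapfrog step `(l, z) ↦ (K_l D_l K_l)(z)` is jointly measurable. -/
theorem measurable_uncurry_sunLeapfrogWord (hε : Measurable ε)
    (hg : Measurable fun q : Lab × (L → Matrix.specialUnitaryGroup n ℂ) => g q.1 q.2) :
    Measurable fun q : Lab × ((L → Matrix.specialUnitaryGroup n ℂ) × (L → E)) =>
      palindromicWord [kick (g q.1)] (drift (mulDrift (sunExpDrift (L := L) ι hι (ε q.1)))) q.2 := by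
  have hK := measurable_uncurry_kick (n := n) (E := E) hg
  have hD := measurable_uncurry_drift ι hι (L := L) (Lab := Lab) hε
  have h : (fun q : Lab × ((L → Matrix.specialUnitaryGroup n ℂ) × (L → E)) =>
      palindromicWord [kick (g q.1)] (drift (mulDrift (sunExpDrift (L := L) ι hι (ε q.1)))) q.2) =
      fun q => kick (g q.1) (drift (mulDrift (sunExpDrift (L := L) ι hι (ε q.1))) (kick (g q.1) q.2)) := by
    funext q; rw [palindromicWord_kick_drift, Equiv.Perm.coe_mul, Equiv.Perm.coe_mul]; rfl
  rw [h]
  exact hK.comp (measurable_fst.prodMk (hD.comp (measurable_fst.prodMk hK)))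

/-- **THE LABELLED `n`-STEP PROPOSAL `(l, (U, p)) ↦ Ψ^{N_l}_{ε_l, g_l}(U, p)` IS JOINTLY MEASURABLE** for measurable
`ε`, `N` and jointly measurable `g`. -/
theorem measurable_uncurry_sunLeapfrogProposalN (hε : Measurable ε) (hN : Measurable N)
    (hg : Measurable fun q : Lab × (L → Matrix.specialUnitaryGroup n ℂ) => g q.1 q.2) :
    Measurable fun q : Lab × ((L → Matrix.specialUnitaryGroup n ℂ) × (L → E)) =>
      sunLeapfrogProposalN ι hι (ε q.1) (g q.1) (N q.1) q.2 := by
  set W : Lab × ((L → Matrix.specialUnitaryGroup n ℂ) × (L → E)) → Lab × ((L → Matrix.specialUnitaryGroup n ℂ) × (L → E)) :=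
    fun q => (q.1, palindromicWord [kick (g q.1)] (drift (mulDrift (sunExpDrift (L := L) ι hι (ε q.1)))) q.2) with hW
  have hWm : Measurable W := measurable_fst.prodMk (measurable_uncurry_sunLeapfrogWord ι hι hε hg)
  have hiter : ∀ (k : ℕ) (q : Lab × ((L → Matrix.specialUnitaryGroup n ℂ) × (L → E))),
      W^[k] q = (q.1, (⇑(palindromicWord [kick (g q.1)] (drift (mulDrift (sunExpDrift (L := L) ι hι (ε q.1))))))^[k] q.2) := by
    intro k; induction k with
    | zero => intro q; rfl
    | succ k ih => intro q; rw [Function.iterate_succ_apply', ih, Function.iterate_succ_apply']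
  -- countably many step numbers
  have hF : Measurable fun r : (Lab × ((L → Matrix.specialUnitaryGroup n ℂ) × (L → E))) × ℕ => (W^[r.2] r.1).2 :=
    measurable_from_prod_countable_left fun k => measurable_snd.comp (hWm.iterate k)
  have hcomp : (fun q : Lab × ((L → Matrix.specialUnitaryGroup n ℂ) × (L → E)) =>
      sunLeapfrogProposalN ι hι (ε q.1) (g q.1) (N q.1) q.2) =
      fun q => flip (W^[N q.1] q).2 := by
    funext q
    rw [hiter, sunLeapfrogProposalN, Equiv.Perm.coe_mul, Function.comp_apply, Equiv.Perm.coe_pow]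
  rw [hcomp]
  exact measurable_flip.comp (hF.comp (measurable_id.prodMk (hN.comp measurable_fst)))

/-- **… hence the jittered proposal on the enlarged phase space is measurable** (`JitteredHMC.jitterMap`). -/
theorem measurable_jitterMap_sunLeapfrogProposalN (hε : Measurable ε) (hN : Measurable N)
    (hg : Measurable fun q : Lab × (L → Matrix.specialUnitaryGroup n ℂ) => g q.1 q.2) :
    Measurable (jitterMap fun l => ⇑(sunLeapfrogProposalN ι hι (ε l) (g l) (N l))) :=
  measurable_jitterMap (measurable_uncurry_sunLeapfrogProposalN ι hι hε hN hg)

end Measurable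

/-! ## §2 The jittered kernel for an arbitrary measurable label space; exact for every law -/

section General

variable {n : Type*} [Fintype n] [DecidableEq n]
variable {E : Type*} [NormedAddCommGroup E] [NormedSpace ℝ E] [MeasurableSpace E] [BorelSpace E]
  [FiniteDimensional ℝ E]
variable (ι : E →ₗ[ℝ] Matrix n n ℂ) (hι : ∀ a, (ι a)ᴴ = -ι a ∧ (ι a).trace = 0)
variable {L : Type*} [Fintype L] (μ : Measure E) (T : (L → E) → ℝ)
variable {Lab : Type*} [MeasurableSpace Lab]
variable {ε : Lab → ℝ} (hε : Measurable ε) {g : Lab → (L → Matrix.specialUnitaryGroup n ℂ) → L → E}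
  (hg : Measurable fun q : Lab × (L → Matrix.specialUnitaryGroup n ℂ) => g q.1 q.2)
  (S : (L → Matrix.specialUnitaryGroup n ℂ) → ℝ) {N : Lab → ℕ} (hN : Measurable N) (η : Measure Lab)

/-- **THE JITTERED LEAPFROG HMC KERNEL ON `SU(N)^links` FOR AN ARBITRARY LABEL SPACE** (`trajectory(τ, nstep,
tau_jitter)` with a continuous jitter law included): refresh the momentum `p ∼ Z_T⁻¹e^{−T}·μ^{⊗links}` and an
independent label `l ∼ η`, run `N_l` P-first leapfrog steps of size `ε_l` with increment `g_l`, flip, Metropolis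
test on `S + T`, forget `(p, l)`.  (`sunJitterHMCN` is the countable-label case.) -/
def sunJitterHMCL : Kernel (L → Matrix.specialUnitaryGroup n ℂ) (L → Matrix.specialUnitaryGroup n ℂ) :=
  jitterHMC (fun l => ⇑(sunLeapfrogProposalN ι hι (ε l) (g l) (N l)))
    (measurable_jitterMap_sunLeapfrogProposalN ι hι hε hN hg) S T η (sunMomentumLaw μ T)

variable {hε hg S hN η T}

/-- **IT IS THE `η`-MIXTURE OF THE FIXED-STEP KERNELS**: `K(U, A) = ∫ K_l(U, A) η(dl)` with
`K_l = sunLeapfrogHMCN ι hι ε_l μ T (g_l) S N_l` (the tree's fixed-step kernel; `g_l` is measurable as a slice). -/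
theorem sunJitterHMCL_apply [SFinite η] (hT : Measurable T) (hS : Measurable S)
    (U : L → Matrix.specialUnitaryGroup n ℂ) {A : Set (L → Matrix.specialUnitaryGroup n ℂ)} (hA : MeasurableSet A) :
    sunJitterHMCL ι hι μ T hε hg S hN η U A =
      ∫⁻ l, sunLeapfrogHMCN ι hι (ε l) μ T (measurable_slice_of_uncurry hg l) S (N l) U A ∂η := by
  haveI : SFinite (sunMomentumLaw (L := L) μ T) := by unfold sunMomentumLaw sunMomentumWeight; infer_instance
  rw [sunJitterHMCL, jitterHMC_apply _ _ η _ hS hT U hA]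
  rfl

/-- The jittered kernel is Markov for every probability law `η` (and `Z_T < ∞`). -/
theorem isMarkovKernel_sunJitterHMCL [μ.IsAddHaarMeasure] [IsProbabilityMeasure η] (hT : Measurable T)
    (hZ : sunMomentumWeight (L := L) μ T univ ≠ ⊤) (hS : Measurable S) :
    IsMarkovKernel (sunJitterHMCL ι hι μ T hε hg S hN η) := by
  haveI := isProbabilityMeasure_sunMomentumLaw (L := L) μ T hT hZ
  unfold sunJitterHMCL
  exact isMarkovKernel_jitterHMC _ _ η _ hS hT

/-- **EXACT FOR EVERY LABEL LAW** — countable or not: the jittered kernel leaves `e^{−S}·Haar^{⊗links}` invariant for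
every probability law `η` on ANY measurable label space, every measurable step assignment `ε`, every jointly
measurable increments `g`, every measurable step numbers `N`, every measurable `S`, every measurable `T` with
`Z_T < ∞`. -/
theorem sunJitterHMCL_invariant [μ.IsAddHaarMeasure] [IsProbabilityMeasure η] (hT : Measurable T)
    (hZ : sunMomentumWeight (L := L) μ T univ ≠ ⊤) (hS : Measurable S) :
    Invariant (sunJitterHMCL ι hι μ T hε hg S hN η)
      ((Measure.pi fun _ : L => haarProbability (Matrix.specialUnitaryGroup n ℂ)).withDensity
        fun u => ENNReal.ofReal (Real.exp (-S u))) :=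
  jitterHMC_exact (vol := Measure.pi fun _ : L => haarProbability (Matrix.specialUnitaryGroup n ℂ))
    (volP := Measure.pi fun _ : L => μ) η hS hT (fun l => involutive_sunLeapfrogProposalN ι hι (ε l) (g l) (N l))
    (fun l => measurePreserving_sunLeapfrogProposalN ι hι (ε l) (N l) μ (measurable_slice_of_uncurry hg l))
    (sunMomentumWeight_univ_ne_zero μ T hT) hZ

/-- **… hence the Gibbs law `gibbsProbability Haar^{⊗links} e^{−S}` is invariant**, for every label law. -/
theorem sunJitterHMCL_invariant_gibbs [μ.IsAddHaarMeasure] [IsProbabilityMeasure η] (hT : Measurable T)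
    (hZ : sunMomentumWeight (L := L) μ T univ ≠ ⊤) (hS : Measurable S) :
    Invariant (sunJitterHMCL ι hι μ T hε hg S hN η)
      (gibbsProbability (Measure.pi fun _ : L => haarProbability (Matrix.specialUnitaryGroup n ℂ))
        fun u => Real.exp (-S u)) :=
  invariant_gibbsProbability (sunJitterHMCL_invariant ι hι μ hT hZ hS)

/-- **A COMMON MINORANT OF THE FROZEN KERNELS OVER A LABEL SET PASSES TO THE JITTERED KERNEL WITH THE FACTOR `η(G)`**:
`W U ≤ K_l U` for all `l ∈ G` (`G` measurable) and all `U` ⇒ `η(G) • W U ≤ K U` for all `U` (`W` any family of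
measures — e.g. `κ · Haar^{⊗links}|_{box(U)}`). -/
theorem smul_le_sunJitterHMCL_of_common_minorant [SFinite η] (hT : Measurable T) (hS : Measurable S)
    {G : Set Lab} (hG : MeasurableSet G)
    {W : (L → Matrix.specialUnitaryGroup n ℂ) → Measure (L → Matrix.specialUnitaryGroup n ℂ)}
    (hW : ∀ l ∈ G, ∀ U, W U ≤ sunLeapfrogHMCN ι hι (ε l) μ T (measurable_slice_of_uncurry hg l) S (N l) U)
    (U : L → Matrix.specialUnitaryGroup n ℂ) :
    η G • W U ≤ sunJitterHMCL ι hι μ T hε hg S hN η U := by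
  refine Measure.le_iff.2 fun A hA => ?_
  rw [Measure.smul_apply, smul_eq_mul, sunJitterHMCL_apply ι hι μ hT hS U hA]
  calc η G * W U A = ∫⁻ _ in G, W U A ∂η := by rw [MeasureTheory.setLIntegral_const, mul_comm]
    _ ≤ ∫⁻ l in G, sunLeapfrogHMCN ι hι (ε l) μ T (measurable_slice_of_uncurry hg l) S (N l) U A ∂η :=
        setLIntegral_mono' hG fun l hl => Measure.le_iff'.1 (hW l hl U) A
    _ ≤ _ := setLIntegral_le_lintegral _ _

end General

/-! ## §3 The engine as run with a general law of the trajectory LENGTH -/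

section Wilson

variable (N d L : ℕ) [NeZero L]

/-- The engine's labelled half kick `(τ', U) ↦ −(τ'/2nstep)·F(U)` is jointly measurable in the length and the
configuration. -/
theorem measurable_uncurry_halfKick_sun {Lk : Type*} {F : (Lk → Matrix.specialUnitaryGroup (Fin N) ℂ) → Lk → SUNCoords N}
    (hF : Measurable F) (nstep : ℕ) :
    Measurable fun q : ℝ × (Lk → Matrix.specialUnitaryGroup (Fin N) ℂ) => (-(q.1 / nstep / 2)) • F q.2 := by
  haveI : OpensMeasurableSpace (ℝ × SUNCoords N) := Prod.opensMeasurableSpace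
  have hc : Measurable fun p : ℝ × SUNCoords N => p.1 • p.2 := continuous_smul.measurable
  exact measurable_pi_lambda _ fun l => hc.comp
    ((((measurable_fst.div_const _).div_const _).neg).prodMk ((measurable_pi_apply l).comp (hF.comp measurable_snd)))

/-- **THE ENGINE'S JITTERED `SU(N)` HMC KERNEL AS RUN, FOR A GENERAL LAW `η` OF THE TRAJECTORY LENGTH**
(`hmc.HMC(f, β, 'leapfrog').trajectory(τ, nstep, tau_jitter)` on the torus `(ℤ/L)^d`; the label IS the drawn length
`τ' ∈ ℝ`): refresh the momenta (coordinates `sunCoordι N`, kinetic term `−Σ tr P²`, Gaussian law) and an independent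
length `τ' ∼ η`; `nstep` P-first leapfrog steps of size `τ'/nstep` with THE ENGINE'S half kick `−(τ'/2nstep)·F(U)`,
`F(U) = sunWilsonForceLaw N β (coeConfig U)`; Metropolis test on `(β/N)·S_W + T`; forget momenta and length. -/
def wilsonJitterHMCL (β : ℝ) (nstep : ℕ) (η : Measure ℝ) :
    Kernel (GaugeConfig d L (Matrix.specialUnitaryGroup (Fin N) ℂ)) (GaugeConfig d L (Matrix.specialUnitaryGroup (Fin N) ℂ)) :=
  sunJitterHMCL (sunCoordι N) (sunCoordι_skew N) (Measure.addHaar : Measure (SUNCoords N)) (sunKinetic N)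
    (ε := fun τ' : ℝ => τ' / nstep) (measurable_id.div_const _)
    (g := fun τ' U => (-(τ' / nstep / 2)) • sunWilsonForceLaw N β (coeConfig U))
    (measurable_uncurry_halfKick_sun N (measurable_sunWilsonForceLaw_coeConfig N (d := d) (L := L) β) nstep)
    (fun U => β / N * wilsonAction (fundamentalRep (Fin N)) U) (N := fun _ => nstep) measurable_const η

variable {N d L}

/-- The kernel is Markov (every probability law `η` of the length). -/
instance isMarkovKernel_wilsonJitterHMCL (β : ℝ) (nstep : ℕ) (η : Measure ℝ) [IsProbabilityMeasure η] :
    IsMarkovKernel (wilsonJitterHMCL N d L β nstep η) :=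
  isMarkovKernel_sunJitterHMCL _ _ _ (measurable_sunKinetic N) (sunMomentumWeight_sunKinetic_ne_top N Measure.addHaar)
    (measurable_engineWilsonAction N β)

/-- **IT IS THE `η`-MIXTURE OF THE ENGINE'S FIXED-LENGTH KERNELS**:
`K(U, A) = ∫ K_{nstep, τ'/nstep}(U, A) η(dτ')`, the integrand being the tree's engine kernel at trajectory length `τ'`
(`sunLeapfrogHMCN` with the half kick `measurable_halfKick_sun … (τ'/nstep)`). -/
theorem wilsonJitterHMCL_apply (β : ℝ) (nstep : ℕ) (η : Measure ℝ) [SFinite η]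
    (U : GaugeConfig d L (Matrix.specialUnitaryGroup (Fin N) ℂ))
    {A : Set (GaugeConfig d L (Matrix.specialUnitaryGroup (Fin N) ℂ))} (hA : MeasurableSet A) :
    wilsonJitterHMCL N d L β nstep η U A =
      ∫⁻ τ', sunLeapfrogHMCN (sunCoordι N) (sunCoordι_skew N) (τ' / nstep) (Measure.addHaar : Measure (SUNCoords N))
        (sunKinetic N) (measurable_halfKick_sun N (measurable_sunWilsonForceLaw_coeConfig N (d := d) (L := L) β) (τ' / nstep))
        (fun U => β / N * wilsonAction (fundamentalRep (Fin N)) U) nstep U A ∂η := by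
  rw [wilsonJitterHMCL, sunJitterHMCL_apply _ _ _ (measurable_sunKinetic N) (measurable_engineWilsonAction N β) U hA]

/-- **EXACT FOR EVERY LAW OF THE TRAJECTORY LENGTH** — atomless (the idealised `tau_jitter` uniform law), atomic (the
code's 53-bit uniform) or anything Borel: `wilsonMeasure (β/N)` is invariant for EVERY `nstep` and EVERY probability
law `η` on `ℝ`. -/
theorem wilsonJitterHMCL_invariant (β : ℝ) (nstep : ℕ) (η : Measure ℝ) [IsProbabilityMeasure η] :
    Invariant (wilsonJitterHMCL N d L β nstep η) (wilsonMeasure (d := d) (L := L) (fundamentalRep (Fin N)) (β / N)) := by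
  rw [← gibbsProbability_smul_wilsonAction_eq N (d := d) (L := L) (fundamentalRep (Fin N)) (β / N)]
  exact sunJitterHMCL_invariant_gibbs (sunCoordι N) (sunCoordι_skew N) Measure.addHaar
    (measurable_sunKinetic N) (sunMomentumWeight_sunKinetic_ne_top N Measure.addHaar) (measurable_engineWilsonAction N β)

/-! ## §4 A common minorant over a set of lengths passes to the engine kernel -/

/-- **`η(G) • W(U, ·) ≤ K(U, ·)` WHENEVER `W` MINORISES THE ENGINE'S FIXED-LENGTH KERNEL FOR EVERY LENGTH IN `G`**
(`G` Borel) — the hypothesis GEN-24's `SUNLeapfrogHMCUniformMinorant.lean` supplies on an interval of short lengths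
with `W = κ · Haar^{⊗links}|_{box_V(U)}`. -/
theorem smul_le_wilsonJitterHMCL_of_common_minorant (β : ℝ) (nstep : ℕ) (η : Measure ℝ) [SFinite η]
    {G : Set ℝ} (hG : MeasurableSet G)
    {W : GaugeConfig d L (Matrix.specialUnitaryGroup (Fin N) ℂ) → Measure (GaugeConfig d L (Matrix.specialUnitaryGroup (Fin N) ℂ))}
    (hW : ∀ τ' ∈ G, ∀ U, W U ≤
      sunLeapfrogHMCN (sunCoordι N) (sunCoordι_skew N) (τ' / nstep) (Measure.addHaar : Measure (SUNCoords N))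
        (sunKinetic N) (measurable_halfKick_sun N (measurable_sunWilsonForceLaw_coeConfig N (d := d) (L := L) β) (τ' / nstep))
        (fun U => β / N * wilsonAction (fundamentalRep (Fin N)) U) nstep U)
    (U : GaugeConfig d L (Matrix.specialUnitaryGroup (Fin N) ℂ)) :
    η G • W U ≤ wilsonJitterHMCL N d L β nstep η U := by
  unfold wilsonJitterHMCL
  exact smul_le_sunJitterHMCL_of_common_minorant _ _ _ (measurable_sunKinetic N) (measurable_engineWilsonAction N β) hG
    (fun τ' hτ' U => hW τ' hτ' U) U

end Wilson

/-! ## §4 (appended by GEN-24 once `JitteredHMCReversible` built) Detailed balance for EVERY label law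

The labelled kernel is not only exact (`sunJitterHMCL_invariant`) but REVERSIBLE: GEN-22's abstract
`jitterHMC_isReversible` (the `η`-mixture of `e^{−H}`-preserving involutive proposals with a shared Metropolis test is
in detailed balance) applied to the jointly measurable labelled leapfrog proposal — no countability of the label space,
so the continuous `tau_jitter` law is covered.  (`sunJitterHMCN_isReversible` is the countable-label case.) -/

section Reversible

variable {n : Type*} [Fintype n] [DecidableEq n]
variable {E : Type*} [NormedAddCommGroup E] [NormedSpace ℝ E] [MeasurableSpace E] [BorelSpace E]
  [FiniteDimensional ℝ E]
variable (ι : E →ₗ[ℝ] Matrix n n ℂ) (hι : ∀ a, (ι a)ᴴ = -ι a ∧ (ι a).trace = 0)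
variable {L : Type*} [Fintype L] (μ : Measure E) {T : (L → E) → ℝ}
variable {Lab : Type*} [MeasurableSpace Lab]
variable {ε : Lab → ℝ} {hε : Measurable ε} {g : Lab → (L → Matrix.specialUnitaryGroup n ℂ) → L → E}
  {hg : Measurable fun q : Lab × (L → Matrix.specialUnitaryGroup n ℂ) => g q.1 q.2}
  {S : (L → Matrix.specialUnitaryGroup n ℂ) → ℝ} {N : Lab → ℕ} {hN : Measurable N} {η : Measure Lab}

/-- **THE JITTERED LEAPFROG HMC ON `SU(N)^links` WITH AN ARBITRARY LABEL LAW IS `e^{−S}·Haar^{⊗links}`-REVERSIBLE**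
— every (possibly atomless) law `η` of the label, every measurable step / step-number / increment assignment,
action and kinetic term. -/
theorem sunJitterHMCL_isReversible [μ.IsAddHaarMeasure] [IsProbabilityMeasure η] (hT : Measurable T)
    (hS : Measurable S) :
    IsReversible (sunJitterHMCL ι hι μ T hε hg S hN η)
      ((Measure.pi fun _ : L => haarProbability (Matrix.specialUnitaryGroup n ℂ)).withDensity
        fun u => ENNReal.ofReal (Real.exp (-S u))) :=
  jitterHMC_isReversible (vol := Measure.pi fun _ : L => haarProbability (Matrix.specialUnitaryGroup n ℂ))
    (volP := Measure.pi fun _ : L => μ) η hS hT (fun l => involutive_sunLeapfrogProposalN ι hι (ε l) (g l) (N l))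
    (fun l => measurePreserving_sunLeapfrogProposalN ι hι (ε l) (N l) μ (measurable_slice_of_uncurry hg l))

end Reversible

section ReversibleWilson

variable (N : ℕ) {d L : ℕ} [NeZero L]

/-- **THE ENGINE'S JITTERED `SU(N)` HMC AS RUN, FOR A GENERAL (E.G. CONTINUOUS UNIFORM) LAW OF THE TRAJECTORY
LENGTH, SATISFIES DETAILED BALANCE WITH RESPECT TO THE WILSON MEASURE** — torus `(ℤ/L)^d`, action `(β/N)·S_W`,
the engine's momenta / kinetic term / Wilson force law / Metropolis test, every `nstep`, every Borel probability
law `η` of the length. -/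
theorem wilsonJitterHMCL_isReversible (β : ℝ) (nstep : ℕ) (η : Measure ℝ) [IsProbabilityMeasure η] :
    IsReversible (wilsonJitterHMCL N d L β nstep η) (wilsonMeasure (d := d) (L := L) (fundamentalRep (Fin N)) (β / N)) := by
  rw [← gibbsProbability_smul_wilsonAction_eq N (d := d) (L := L) (fundamentalRep (Fin N)) (β / N), gibbsProbability]
  unfold wilsonJitterHMCL
  exact isReversible_smul (sunJitterHMCL_isReversible (sunCoordι N) (sunCoordι_skew N) Measure.addHaar
    (measurable_sunKinetic N) (measurable_engineWilsonAction N β)) _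

end ReversibleWilson

end Summit.Ventures.LatticeQCDFlow.Exactness
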